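import Mathlib
import Summits.ValiantsHypothesis.ValiantsHypothesis.Theorems.GrenetZeonPolySizeQPAlgebraCornerFour
import Summits.ValiantsHypothesis.ValiantsHypothesis.Theorems.GrenetZeonPolySizeQPAlgebraGoodSpaceMono
import HarnessLib

/-!
# Crux `GrenetZeon.PolySizeQPAlgebra` (stmt-ValiantsHypothesis-8064), line `vbp-slice-dealg` —
# the point `(n, 4)`: residual type under ANY good `c`-space (`c ≥ 5`), and a CORRECTION of record

`…CornerFour` (`hasAlgDetRepr_four_residual_of_goodFiveSpace`): a good `5`-space with threshold `8n` leaves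
exactly one type of `(n, 4)`-witness of `per_n`, a single local Frobenius piece of dimension `4` with `𝔪³ = 0`
(`≅ ℂ[x,y]/(x²,y²)`).  This file restates it for any good `c`-space with `c ≥ 5` and threshold `t ≥ 8n`
(`goodSpace_restrict`, `goodSpace_mono`), the form in which a bordered `5 × 5` circulant-core design
(threshold `10(p-1)²`) would be consumed.

CORRECTION OF RECORD (supersedes the aside «on which the jet engine is known to fail» in the docstring of
`hasAlgDetRepr_four_residual_of_goodFiveSpace`): exact computations (hand folder `calc/jet_xy_fast.py`,
principal-minor expansion, `n ≤ 12`) show that for the residual type `ℂ[x,y]/(x²,y²)` the Hessian of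
`λ(det L)` at a corank-one zero of `det A₀` where `det L` vanishes in `R` has rank `8n - 12` (`n ≥ 6`) — the
same LINEAR law `2·dim(R)·n` as for curvilinear pieces (`rank_hess0_jet_le`); the values `n²` seen for
`n ≤ 6` are only the coincidence `8n - 12 ≥ n²` there.  A proof (not yet in the tree; M-sized): change the
representation by `L ↦ (1 + xN) L (1 + xN')`, `(1 + yM) · (1 + yM')` with constant `N, N', M, M'` (the
functional changes by a unit, the jets by `D_x ↦ D_x + τ D₀`, `D_xy ↦ D_xy + τ D_y`) so that `A₁(p) = A₂(p) = 0`
— possible exactly because `D_x(p) = D_y(p) = 0` —; then `D_x + y D_xy = tr(adj(A₀ + yA₂)(A₁ + yA₃))` splits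
by the row expansion of `…JetHessian` into a row part, `det B'`, and two dual traces each vanishing at `p`
(`…DualJet`), and `D₀ + y D_y` is an order-`2` jet form: rank `≤ 16n`.  With it, the point `(n, 4)` reduces to
a good `5`-space with threshold `16n` exactly as `(n, 3)` reduces to a good `4`-space with threshold `6n`.

HONEST FRAMING: glue and a correction note; no stub of the line is closed; VP ≠ VNP is not moved.
-/

noncomputable section

open MvPolynomial Matrix
open Literature.Computability.AlgebraicComplexity

-- single-conjunct layout `Summits/ValiantsHypothesis/ValiantsHypothesis`: duplicated namespace by design
set_option linter.dupNamespace false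

namespace Summit.ValiantsHypothesis.ValiantsHypothesis.Theorems.GrenetZeonPolySizeQPAlgebra

/-- **Residual type at `(n, 4)` under any good `c`-space, `c ≥ 5`, threshold `t ≥ 8n`.**  Every
`(n, 4)`-representation of `per_n` (`n ≥ 1`) is then carried by a single local Frobenius piece `(R, φ, λ, A)` of
dimension `4` with `e³ = 0` on `ker φ` (the type `ℂ[x,y]/(x²,y²)`; its Hessian law is `8n - 12` numerically —
see the module docstring — so only the corresponding rank lemma separates `(n, 4)` from a good `5`-space).
[cite: MignonRessayre2004, §2] -/
theorem hasAlgDetRepr_four_residual_of_goodSpace {n c t : ℕ} (hn : 1 ≤ n) (hc : 5 ≤ c) (ht : 8 * n ≤ t)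
    (hW : ∃ w : Fin c → (Fin n × Fin n → ℂ), LinearIndependent ℂ w ∧
      ∀ a : Fin c → ℂ, a ≠ 0 → eval (∑ i, a i • w i) (perPoly (Fin n) ℂ) = 0 →
        t < (hess0 (transl (∑ i, a i • w i) (perPoly (Fin n) ℂ))).rank)
    (h : HasAlgDetRepr (perPoly (Fin n) ℂ) n 4) :
    ∃ (R : Type) (_ : CommRing R) (_ : Algebra ℂ R) (_ : Module.Finite ℂ R) (φ : R →ₐ[ℂ] ℂ),
      Module.finrank ℂ R = 4 ∧ (∀ e : R, φ e = 0 → e ^ 3 = 0) ∧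
        ∃ (l : R →ₗ[ℂ] ℂ) (A : Matrix (Fin n) (Fin n) (MvPolynomial (Fin n × Fin n) R)),
          (∀ a b, (A a b).IsHomogeneous 1) ∧
            (∀ d : (Fin n × Fin n) →₀ ℕ, l (coeff d A.det) = coeff d (perPoly (Fin n) ℂ)) ∧
              ∀ r : R, (∀ x, l (x * r) = 0) → r = 0 :=
  hasAlgDetRepr_four_residual_of_goodFiveSpace hn (goodSpace_mono ht (goodSpace_restrict hc hW)) h

/-- **All large `n`:** good `c_n`-spaces (`c_n ≥ 5`, thresholds `≥ 8n`) for all large `n` leave, for all large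
`n`, only the residual type at the point `(n, 4)` and nothing at `(m, s) ≤ (n, 3)`. [folklore] -/
theorem corner_four_all_large_of_goodSpaces
    (hW : ∃ n₀ : ℕ, ∀ n ≥ n₀, ∃ c t : ℕ, 5 ≤ c ∧ 8 * n ≤ t ∧
      ∃ w : Fin c → (Fin n × Fin n → ℂ), LinearIndependent ℂ w ∧
        ∀ a : Fin c → ℂ, a ≠ 0 → eval (∑ i, a i • w i) (perPoly (Fin n) ℂ) = 0 →
          t < (hess0 (transl (∑ i, a i • w i) (perPoly (Fin n) ℂ))).rank) :
    ∃ n₀ : ℕ, ∀ n ≥ n₀, (∀ m s : ℕ, m ≤ n → s ≤ 3 → ¬ HasAlgDetRepr (perPoly (Fin n) ℂ) m s) ∧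
      (HasAlgDetRepr (perPoly (Fin n) ℂ) n 4 →
        ∃ (R : Type) (_ : CommRing R) (_ : Algebra ℂ R) (_ : Module.Finite ℂ R) (φ : R →ₐ[ℂ] ℂ),
          Module.finrank ℂ R = 4 ∧ (∀ e : R, φ e = 0 → e ^ 3 = 0) ∧
            ∃ (l : R →ₗ[ℂ] ℂ) (A : Matrix (Fin n) (Fin n) (MvPolynomial (Fin n × Fin n) R)),
              (∀ a b, (A a b).IsHomogeneous 1) ∧
                (∀ d : (Fin n × Fin n) →₀ ℕ, l (coeff d A.det) = coeff d (perPoly (Fin n) ℂ)) ∧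
                  ∀ r : R, (∀ x, l (x * r) = 0) → r = 0) := by
  obtain ⟨n₀, hgood⟩ := hW
  refine ⟨max n₀ 1, fun n hn => ?_⟩
  obtain ⟨c, t, hc, ht, hWn⟩ := hgood n (le_of_max_le_left hn)
  have hn1 : 1 ≤ n := le_of_max_le_right hn
  exact ⟨fun m s hm hs => not_hasAlgDetRepr_perPoly_le_three_of_goodSpace hn1 (by omega) (by omega) hWn hm hs,
    fun h => hasAlgDetRepr_four_residual_of_goodSpace hn1 hc ht hWn h⟩

end Summit.ValiantsHypothesis.ValiantsHypothesis.Theorems.GrenetZeonPolySizeQPAlgebra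

end
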